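import Literature.Computability.Complexity.CyclicListArith
import Mathlib.Algebra.Polynomial.Monic
import HarnessLib

/-!
# Cyclic list arithmetic, II: the lists denote `ℤ_n[X]/(X^r - 1)` arithmetic

Continuation of `CyclicListArith.lean` (the list-level model `CycList.rot/axpy/mul/powAux/lhs/rhs`
of the polynomial identity test of the AKS algorithm, [AKS04, §4 step 5, §5]). Here the meaning of
those lists in `AdjoinRoot (X^r - 1 : (ZMod n)[X])` (`CycList.toQ`):

* `toQ_rot` (`rot` is multiplication by `X`), `toPoly_axpy`, `toQ_mul` (Horner's rule computes the
  product), `toQ_powAux` (square-and-multiply computes `acc · base ^ (e mod 2ᵏ)`), `toQ_xpow`,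
  `toQ_lhs = (X + a)^n`, `toQ_rhs = X^n + a`;
* **`CycList.lhs_eq_rhs_iff`**: for `n, r ≥ 2`, the computed lists agree iff
  `X^r - 1 ∣ (X + a)^n - (X^n + a)` in `(ZMod n)[X]` — the congruence tested by step 5 of the
  AKS algorithm, in the form consumed by `Literature.NumberTheory.Primality.AKS.introspective_of_congruence`.

## References

* [AKS04] M. Agrawal, N. Kayal, N. Saxena, *PRIMES is in P*, Ann. of Math. 160 (2004) 781–793,
  §4 (step 5 of the algorithm), §5 (Thm 5.1).
* D. E. Knuth, *The Art of Computer Programming*, Vol. 2, 3rd ed., 1998, §4.6.1, §4.6.3.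
-/

namespace Literature.Computability.Complexity

open Polynomial

namespace CycList

variable {r n : ℕ}

/-- `X ^ r = 1` in `ℤ_n[X]/(X^r - 1)`. [folklore] -/
theorem mkX_pow_r (r n : ℕ) : (AdjoinRoot.mk (X ^ r - 1 : (ZMod n)[X]) X) ^ r = 1 := by
  rw [← map_pow, ← sub_eq_zero, ← map_one (AdjoinRoot.mk (X ^ r - 1 : (ZMod n)[X])), ← map_sub,
    AdjoinRoot.mk_self]

/-- Hence `X ^ m = X ^ (m mod r)` there. [folklore] -/
theorem mkX_pow_eq_pow_mod (r n m : ℕ) :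
    (AdjoinRoot.mk (X ^ r - 1 : (ZMod n)[X]) X) ^ m = (AdjoinRoot.mk (X ^ r - 1 : (ZMod n)[X]) X) ^ (m % r) := by
  conv_lhs => rw [← Nat.div_add_mod m r, pow_add, pow_mul, mkX_pow_r, one_pow, one_mul]

/-- **`rot` is multiplication by `X`** on lists of length `r`. [cite: AgrawalKayalSaxena2004, §5] -/
theorem toQ_rot {l : List ℕ} (hl : l.length = r) : toQ r n (rot l) = AdjoinRoot.mk _ X * toQ r n l := by
  cases l with
  | nil => simp [rot, toQ]
  | cons h t =>
    rw [toQ, toQ, ← map_mul, rot, AdjoinRoot.mk_eq_mk, toPoly_append_singleton, toPoly_cons]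
    simp only [List.length_cons] at hl
    refine ⟨-C (h : ZMod n), ?_⟩
    rw [← hl, pow_succ]
    ring

/-- **`axpy` is `a • B + C`** on lists of equal length. [cite: KnuthTAOCP2, §4.6.1] -/
theorem toPoly_axpy (n a : ℕ) : ∀ {B C : List ℕ}, B.length = C.length →
    toPoly n (axpy n a B C) = Polynomial.C (a : ZMod n) * toPoly n B + toPoly n C
  | [], [], _ => by simp [axpy]
  | [], _ :: _, h => by simp at h
  | _ :: _, [], h => by simp at h
  | b :: B, c :: C, h => by
    simp only [List.length_cons, Nat.add_right_cancel_iff] at h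
    have ih := toPoly_axpy n a h
    simp only [axpy, List.zipWith_cons_cons, toPoly_cons, List.length_zipWith] at ih ⊢
    rw [ih, h, min_self, ZMod.natCast_mod]
    push_cast
    rw [map_add, map_mul]
    ring

/-- `axpy` in the quotient. [folklore] -/
theorem toQ_axpy (a : ℕ) {B C : List ℕ} (h : B.length = C.length) :
    toQ r n (axpy n a B C) = AdjoinRoot.mk _ (Polynomial.C (a : ZMod n)) * toQ r n B + toQ r n C := by
  rw [toQ, toPoly_axpy n a h, map_add, map_mul]; rfl

/-- **Horner's rule**: folding `acc := X • acc + aᵢ • B` over `A` from `acc` yields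
`X^{|A|} • acc + A • B`. [cite: KnuthTAOCP2, §4.6.1] -/
theorem toQ_foldl_axpy (hB : ∀ {l : List ℕ}, l.length = r → (rot l).length = r := fun h => by simp [h])
    {B : List ℕ} (hBr : B.length = r) : ∀ (A acc : List ℕ), acc.length = r →
    toQ r n (A.foldl (fun acc a => axpy n a B (rot acc)) acc) =
      AdjoinRoot.mk _ X ^ A.length * toQ r n acc + toQ r n A * toQ r n B
  | [], acc, _ => by simp [toQ]
  | a :: A, acc, hacc => by
    rw [List.foldl_cons, toQ_foldl_axpy hB hBr A _ (by simp [hBr, hacc]),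
      toQ_axpy a (by simp [hBr, hacc]), toQ_rot hacc]
    simp only [toQ, toPoly_cons, List.length_cons, map_add, map_mul, map_pow]
    ring

/-- **The product is the product**: `toQ (mul n A B) = toQ A * toQ B` for lists of length `r`.
[cite: AgrawalKayalSaxena2004, §5] -/
theorem toQ_mul {A B : List ℕ} (hA : A.length = r) (hB : B.length = r) :
    toQ r n (mul n A B) = toQ r n A * toQ r n B := by
  rw [mul, toQ_foldl_axpy (fun h => by simp [h]) hB A _ (by simp [hA]), hA]
  have : toQ r n (List.replicate r 0) = 0 := by simp [toQ, ← zero.eq_1]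
  rw [this, mul_zero, zero_add]

/-- The bottom binary digit splits off a remainder modulo `2^(k+1)`. [folklore] -/
theorem mod_two_pow_succ (e k : ℕ) : e % 2 ^ (k + 1) = e % 2 + 2 * (e / 2 % 2 ^ k) := by
  have h1 := Nat.div_add_mod e 2
  have h2 := Nat.div_add_mod (e / 2) (2 ^ k)
  have h3 := Nat.mod_lt (e / 2) (Nat.two_pow_pos k)
  have h4 := Nat.mod_lt e (Nat.two_pow_pos 1)
  have he : e = 2 ^ (k + 1) * (e / 2 / 2 ^ k) + (e % 2 + 2 * (e / 2 % 2 ^ k)) := by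
    rw [pow_succ]; nlinarith
  conv_lhs => rw [he]
  rw [Nat.mul_add_mod, Nat.mod_eq_of_lt]
  rw [pow_succ]; omega

/-- **Square-and-multiply**: `k` rounds from `(e, acc, base)` compute `acc · base ^ (e mod 2ᵏ)`.
[cite: KnuthTAOCP2, §4.6.3 (Algorithm A)] -/
theorem toQ_powAux : ∀ (k e : ℕ) {acc base : List ℕ}, acc.length = r → base.length = r →
    toQ r n (powAux n k e acc base) = toQ r n acc * toQ r n base ^ (e % 2 ^ k)
  | 0, e, acc, base, _, _ => by simp [powAux, Nat.mod_one]
  | k + 1, e, acc, base, ha, hb => by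
    rw [powAux, toQ_powAux k (e / 2) ?_ (by rw [length_mul n rfl, hb]), toQ_mul hb hb, mod_two_pow_succ,
      pow_add, pow_mul, sq]
    · split_ifs with he
      · rw [toQ_mul ha hb, he, pow_one]; ring
      · have : e % 2 = 0 := by omega
        rw [this, pow_zero, one_mul]
    · split_ifs
      · rw [length_mul n (ha.trans hb.symm), hb]
      · exact ha

/-- `one r` denotes `1`. [folklore] -/
@[simp] theorem toQ_one (r n : ℕ) : toQ r n (one r) = 1 := by simp [toQ]

/-- `X^m` is `X^m`. [folklore] -/
theorem toQ_xpow (hr : 1 ≤ r) (m : ℕ) : toQ r n (xpow r m) = AdjoinRoot.mk _ X ^ m := by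
  induction m with
  | zero => simp [xpow]
  | succ m ih =>
    rw [xpow, Function.iterate_succ_apply', toQ_rot (by simp [length_one hr]), ← xpow, ih, pow_succ, mul_comm]

/-- **The right-hand side**: `toQ (rhs r n a) = X^n + a` (`r ≥ 1`). [cite: AgrawalKayalSaxena2004, §4 (step 5)] -/
theorem toQ_rhs (hr : 1 ≤ r) (n a : ℕ) :
    toQ r n (rhs r n a) = AdjoinRoot.mk _ (X ^ n + Polynomial.C (a : ZMod n)) := by
  rw [rhs, toQ_axpy 1 (by simp [length_xpow hr, length_constP hr]), toQ_xpow hr, ← mkX_pow_eq_pow_mod,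
    map_add, map_pow]
  simp [toQ]

/-- **The left-hand side**: `toQ (lhs r n a) = (X + a)^n` (`r ≥ 2`). [cite: AgrawalKayalSaxena2004, §5] -/
theorem toQ_lhs (hr : 2 ≤ r) (n a : ℕ) :
    toQ r n (lhs r n a) = AdjoinRoot.mk _ ((X + Polynomial.C (a : ZMod n)) ^ n) := by
  rw [lhs, toQ_powAux _ _ (length_one (by omega)) (length_linear hr n a), Nat.mod_eq_of_lt (Nat.lt_size_self n),
    toQ_one, one_mul, map_pow]
  simp [toQ]

/-- A multiple of `X^r - 1` of degree `< r` vanishes (`n ≥ 2`, so that `ZMod n` is nontrivial and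
`X^r - 1` is monic of degree `r`). [folklore] -/
theorem eq_zero_of_dvd_of_degree_lt (hn : 2 ≤ n) (hr : 1 ≤ r) {q : (ZMod n)[X]}
    (hdvd : (X ^ r - 1 : (ZMod n)[X]) ∣ q) (hdeg : q.degree < r) : q = 0 := by
  haveI : Fact (1 < n) := ⟨hn⟩
  by_contra hq
  have hmonic : Monic (X ^ r - 1 : (ZMod n)[X]) := by
    simpa using monic_X_pow_sub_C (1 : ZMod n) (show r ≠ 0 by omega)
  refine hmonic.not_dvd_of_degree_lt hq ?_ hdvd
  rwa [show (X ^ r - 1 : (ZMod n)[X]) = X ^ r - Polynomial.C 1 by simp, degree_X_pow_sub_C (by omega)]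

/-- **`toQ` is injective on reduced lists of length `r`** (`n ≥ 2`). [folklore] -/
theorem eq_of_toQ_eq (hn : 2 ≤ n) (hr : 1 ≤ r) {l₁ l₂ : List ℕ} (h₁ : Reduced n l₁) (h₂ : Reduced n l₂)
    (hl₁ : l₁.length = r) (hl₂ : l₂.length = r) (h : toQ r n l₁ = toQ r n l₂) : l₁ = l₂ := by
  rw [toQ, toQ, AdjoinRoot.mk_eq_mk] at h
  refine eq_of_toPoly_eq h₁ h₂ (hl₁.trans hl₂.symm) (sub_eq_zero.1 (eq_zero_of_dvd_of_degree_lt hn hr h ?_))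
  refine (degree_sub_le _ _).trans_lt (max_lt ?_ ?_)
  · simpa [hl₁] using degree_toPoly_lt n l₁
  · simpa [hl₂] using degree_toPoly_lt n l₂

/-- **The computed lists decide the AKS congruence.** For `n, r ≥ 2` and any `a`,
`lhs r n a = rhs r n a` iff `X^r - 1 ∣ (X + a)^n - (X^n + a)` in `(ZMod n)[X]`, i.e. iff
`(X + a)^n ≡ X^n + a (mod X^r - 1, n)`. [cite: AgrawalKayalSaxena2004, §4 (step 5) and §5] -/
theorem lhs_eq_rhs_iff (hn : 2 ≤ n) (hr : 2 ≤ r) (a : ℕ) :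
    lhs r n a = rhs r n a ↔
      (X ^ r - 1 : (ZMod n)[X]) ∣ (X + Polynomial.C (a : ZMod n)) ^ n - (X ^ n + Polynomial.C (a : ZMod n)) := by
  rw [← AdjoinRoot.mk_eq_mk, ← toQ_lhs hr, ← toQ_rhs (by omega)]
  constructor
  · intro h; rw [h]
  · exact eq_of_toQ_eq hn (by omega) (reduced_lhs hn r a) (reduced_rhs (by omega) r a) (length_lhs hr n a)
      (length_rhs (by omega) n a)

end CycList

end Literature.Computability.Complexity
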